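import Mathlib.Algebra.Order.BigOperators.Group.Finset
import Literature.AnabelianGeometry.SemiGraphs.FibreDataLabelledLift

/-!
# A graph-covering meeting every closed family of components is bijective ([SemiAnbd] §1 p. 14, §2 p. 23)

Mochizuki, *Semi-graphs of anabelioids*, Publ. RIMS **42** (2006) 221–322, §1 p. 14 (graph-coverings
= proper excisions) and §2 p. 23 (the vertices/edges of the finite étale covering attached to
`G′ ∈ B(𝒢)` over `v`/`e` ARE the connected components of `S_v`/`T_e`) [cite: MochizukiSemiAnbd2006, §1 p.14].

PROOF-ONLY combinatorics (abc-iut cell, layer L3; FACT-LIST row F-1478 `remark_2_4_1_covering`, residual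
GAP-LEDGER G-w5d041-g4-1 «tie WITHOUT connectedness»; seat abc-iut-f-161).  The degree count of
`GraphCoveringDegreeOne` (abc-iut-f-161 (T-γ)) needs a CONNECTED target.  Here the connectedness
hypothesis is replaced by the weakest hypothesis that survives in the disconnected case:

* `Hom.bijective_of_surjective_of_natCard_fiber_eq` — a morphism `θ : 𝔾′ → 𝔾` over a base `𝕂` with
  finite fibres over `𝕂` of the SAME cardinalities for `𝔾′ → 𝕂` and `𝔾 → 𝕂`, which is SURJECTIVE on
  vertices and on edges, is bijective (`Σ_{v ∈ π⁻¹(u)} #θ⁻¹(v) = #π′⁻¹(u) = #π⁻¹(u)` with all terms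
  `≥ 1`);
* `FibreData.surjective_of_hits` — a graph-covering `θ : 𝔾′ → D.total` into the total semi-graph of
  fibre data whose image meets every nonempty family of components CLOSED under "the component under"
  (`σ`) is surjective: the image is closed under incidence in both directions (excision lifts the
  branches at an image vertex, properness makes a branch over an abutting branch abut);
* `FibreData.labels_bijective_of_hits` — **the labels of `FibreData.labels_bijective` are bijections
  as soon as every nonempty `σ`-closed family of components contains a label** (instead of
  `D.total` connected).

Consumer: the tie of a four-clause finite étale covering `ℋ → 𝒦` WITHOUT connectedness hypotheses on
`ℋ`, `𝒦` (`TieBijectiveGeneral`), the closed families being met because the global equivalence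
`B(𝒦)_{/A} ⥲ B(ℋ)` carries the sub-object of `A` they define to a non-initial object.  Pure semi-graph
theory; no `def`, no `Prop` introduced; nothing here takes a side on [IUTchIII] Cor. 3.12.
-/

namespace Literature.AnabelianGeometry.SemiGraphs

namespace SemiGraph

open CategoryTheory

universe u

variable {G G' : SemiGraph.{u}}

/-! ### Surjective morphisms with the base's fibre cardinalities are bijective -/

/-- Fibres of a composite decompose over the fibres of the second map (vertices). [folklore] -/
private theorem natCard_vertexFiber_comp' {K : SemiGraph.{u}} (θ : G' ⟶ G) (π : G ⟶ K) (u : K.Vertex)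
    [Fintype (π.VertexFiber u)] [∀ v, Finite (θ.VertexFiber v)] :
    Nat.card ((θ ≫ π).VertexFiber u) = ∑ v : π.VertexFiber u, Nat.card (θ.VertexFiber v.1) := by
  rw [← Nat.card_sigma]
  exact (Nat.card_congr (Equiv.sigmaSubtypeFiberEquivSubtype θ.vertexMap
    (p := fun v' => π.vertexMap (θ.vertexMap v') = u) (q := fun v => π.vertexMap v = u)
    (fun _ => Iff.rfl))).symm

/-- Fibres of a composite decompose over the fibres of the second map (edges). [folklore] -/
private theorem natCard_edgeFiber_comp' {K : SemiGraph.{u}} (θ : G' ⟶ G) (π : G ⟶ K) (u : K.Edge)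
    [Fintype (π.EdgeFiber u)] [∀ e, Finite (θ.EdgeFiber e)] :
    Nat.card ((θ ≫ π).EdgeFiber u) = ∑ e : π.EdgeFiber u, Nat.card (θ.EdgeFiber e.1) := by
  rw [← Nat.card_sigma]
  exact (Nat.card_congr (Equiv.sigmaSubtypeFiberEquivSubtype θ.edgeMap
    (p := fun e' => π.edgeMap (θ.edgeMap e') = u) (q := fun e => π.edgeMap e = u)
    (fun _ => Iff.rfl))).symm

/-- A map all of whose fibres have exactly one element is bijective. [folklore] -/
private theorem bijective_of_natCard_fiber_eq_one' {α β : Type u} (f : α → β)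
    (h : ∀ b, Nat.card {a : α // f a = b} = 1) : Function.Bijective f := by
  rw [Function.bijective_iff_existsUnique]
  intro b
  obtain ⟨hs, ⟨a⟩⟩ := Nat.card_eq_one_iff_unique.mp (h b)
  exact ⟨a.1, a.2, fun a' ha' => congrArg Subtype.val (hs.elim ⟨a', ha'⟩ a)⟩

/-- In a finite sum of natural numbers with all terms `≥ 1` and total equal to the number of terms,
every term is `1`. [folklore] -/
private theorem eq_one_of_sum_eq_card {ι : Type u} [Fintype ι] (f : ι → ℕ) (h1 : ∀ i, 1 ≤ f i)
    (hsum : ∑ i, f i = Fintype.card ι) (i : ι) : f i = 1 := by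
  have hsum' : ∑ _i : ι, (1 : ℕ) = ∑ i, f i := by
    rw [Finset.sum_const, Finset.card_univ, smul_eq_mul, Nat.mul_one, hsum]
  exact ((Finset.sum_eq_sum_iff_of_le fun j _ => h1 j).mp hsum' i (Finset.mem_univ i)).symm

/-- **A surjective morphism over a common base with the base's fibre cardinalities is bijective**
([SemiAnbd] §1 p. 14 degree count, without connectedness).  Let `θ : 𝔾′ → 𝔾` be a morphism over a base
`𝕂` (`θ ≫ π = π′`) such that over every vertex and every edge of `𝕂` the fibres of `π′` and of `π` are
finite of the same cardinality, and suppose `θ` is surjective on vertices and on edges.  Then `θ` is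
bijective on vertices and on edges: `Σ_{v ∈ π⁻¹(u)} #θ⁻¹(v) = #π′⁻¹(u) = #π⁻¹(u)` with every term `≥ 1`
forces every term to be `1`. [cite: MochizukiSemiAnbd2006, §1 p.14] -/
theorem Hom.bijective_of_surjective_of_natCard_fiber_eq {K : SemiGraph.{u}} (θ : G' ⟶ G)
    {π : G ⟶ K} {π' : G' ⟶ K} (hcomm : θ ≫ π = π')
    [∀ u, Finite (π.VertexFiber u)] [∀ u, Finite (π'.VertexFiber u)]
    [∀ e, Finite (π.EdgeFiber e)] [∀ e, Finite (π'.EdgeFiber e)]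
    (hV : ∀ u, Nat.card (π'.VertexFiber u) = Nat.card (π.VertexFiber u))
    (hE : ∀ e, Nat.card (π'.EdgeFiber e) = Nat.card (π.EdgeFiber e))
    (hsV : Function.Surjective θ.vertexMap) (hsE : Function.Surjective θ.edgeMap) :
    Function.Bijective θ.vertexMap ∧ Function.Bijective θ.edgeMap := by
  classical
  subst hcomm
  -- the fibres of `θ` are finite: they embed into the fibres of `θ ≫ π`
  haveI hfinV : ∀ v, Finite (θ.VertexFiber v) := fun v =>
    Finite.of_injective (fun v' : θ.VertexFiber v =>
      (⟨v'.1, by change π.vertexMap (θ.vertexMap v'.1) = π.vertexMap v; rw [v'.2]⟩ :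
        (θ ≫ π).VertexFiber (π.vertexMap v)))
      (fun a b hab => Subtype.ext (congrArg (fun x => x.1) hab))
  haveI hfinE : ∀ e, Finite (θ.EdgeFiber e) := fun e =>
    Finite.of_injective (fun e' : θ.EdgeFiber e =>
      (⟨e'.1, by change π.edgeMap (θ.edgeMap e'.1) = π.edgeMap e; rw [e'.2]⟩ :
        (θ ≫ π).EdgeFiber (π.edgeMap e)))
      (fun a b hab => Subtype.ext (congrArg (fun x => x.1) hab))
  -- every fibre of `θ` has at least one element
  have h1V : ∀ v, 1 ≤ Nat.card (θ.VertexFiber v) := fun v => by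
    obtain ⟨v', hv'⟩ := hsV v
    haveI : Nonempty (θ.VertexFiber v) := ⟨⟨v', hv'⟩⟩
    exact Nat.one_le_iff_ne_zero.mpr (Nat.card_pos (α := θ.VertexFiber v)).ne'
  have h1E : ∀ e, 1 ≤ Nat.card (θ.EdgeFiber e) := fun e => by
    obtain ⟨e', he'⟩ := hsE e
    haveI : Nonempty (θ.EdgeFiber e) := ⟨⟨e', he'⟩⟩
    exact Nat.one_le_iff_ne_zero.mpr (Nat.card_pos (α := θ.EdgeFiber e)).ne'
  -- … and exactly one, counting over the base
  have keyV : ∀ v, Nat.card (θ.VertexFiber v) = 1 := fun v => by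
    letI : Fintype (π.VertexFiber (π.vertexMap v)) := Fintype.ofFinite _
    have hsum := natCard_vertexFiber_comp' θ π (π.vertexMap v)
    rw [hV, Nat.card_eq_fintype_card] at hsum
    exact eq_one_of_sum_eq_card (fun v' : π.VertexFiber (π.vertexMap v) => Nat.card (θ.VertexFiber v'.1))
      (fun v' => h1V v'.1) hsum.symm ⟨v, rfl⟩
  have keyE : ∀ e, Nat.card (θ.EdgeFiber e) = 1 := fun e => by
    letI : Fintype (π.EdgeFiber (π.edgeMap e)) := Fintype.ofFinite _
    have hsum := natCard_edgeFiber_comp' θ π (π.edgeMap e)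
    rw [hE, Nat.card_eq_fintype_card] at hsum
    exact eq_one_of_sum_eq_card (fun e' : π.EdgeFiber (π.edgeMap e) => Nat.card (θ.EdgeFiber e'.1))
      (fun e' => h1E e'.1) hsum.symm ⟨e, rfl⟩
  exact ⟨bijective_of_natCard_fiber_eq_one' θ.vertexMap keyV,
    bijective_of_natCard_fiber_eq_one' θ.edgeMap keyE⟩

/-! ### A graph-covering meeting every closed family of components is surjective -/

namespace FibreData

variable {K : SemiGraph.{u}} (D : K.FibreData)

/-- **Surjectivity from meeting every closed family.**  Let `θ : 𝔾′ → D.total` be a graph-covering into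
the total semi-graph of fibre data `D` over `𝕂`.  Suppose that every family of components
`S_V(u) ⊆ F(u)`, `S_E(e) ⊆ F(e)` which is CLOSED under "the component under" — a component `c` over the
edge of a branch `b` abutting to `u` is selected iff `σ_b c` is — and nonempty contains the image of a
vertex or of an edge of `𝔾′`.  Then `θ` is surjective on vertices and on edges: the complement of the
image is such a closed family (a branch over an abutting branch abuts, by properness; the branches at an
image vertex are images, by excision). [cite: MochizukiSemiAnbd2006, §1 p.14] -/
theorem surjective_of_hits {θ : G' ⟶ D.total} (hθ : IsGraphCovering θ)
    (hhit : ∀ (SV : ∀ u, Set (D.FV u)) (SE : ∀ e, Set (D.FE e)),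
      (∀ (b : K.Branch) (u : K.Vertex) (hb : K.abuts b = some u) (c : D.FE (K.edgeOf b)),
        c ∈ SE (K.edgeOf b) ↔ D.σ b u hb c ∈ SV u) →
      ((∃ u x, x ∈ SV u) ∨ (∃ e c, c ∈ SE e)) →
      (∃ w, (θ.vertexMap w).2 ∈ SV (θ.vertexMap w).1) ∨
        (∃ e', (θ.edgeMap e').2 ∈ SE (θ.edgeMap e').1)) :
    Function.Surjective θ.vertexMap ∧ Function.Surjective θ.edgeMap := by
  obtain ⟨hp, hx⟩ := hθ
  -- the complement of the image
  let SV : ∀ u, Set (D.FV u) := fun u => {x | ∀ w, θ.vertexMap w ≠ ⟨u, x⟩}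
  let SE : ∀ e, Set (D.FE e) := fun e => {c | ∀ e', θ.edgeMap e' ≠ ⟨e, c⟩}
  -- it is closed under "the component under"
  have hclosed : ∀ (b : K.Branch) (u : K.Vertex) (hb : K.abuts b = some u) (c : D.FE (K.edgeOf b)),
      c ∈ SE (K.edgeOf b) ↔ D.σ b u hb c ∈ SV u := by
    intro b u hb c
    have habuts : D.total.abuts ⟨b, c⟩ = some ⟨u, D.σ b u hb c⟩ := D.total_abuts_eq hb c
    change (∀ e', θ.edgeMap e' ≠ ⟨K.edgeOf b, c⟩) ↔ ∀ w, θ.vertexMap w ≠ ⟨u, D.σ b u hb c⟩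
    constructor
    · -- a vertex over `(u, σ_b c)` carries a branch over `(b, c)` (excision), whose edge is over `(e, c)`
      intro he w hw
      let b' := Hom.branchLift hx (⟨b, c⟩ : D.total.Branch) ⟨u, D.σ b u hb c⟩ habuts ⟨w, hw⟩
      refine he (G'.edgeOf b'.1) ?_
      rw [← θ.edgeOf_branchMap, Hom.branchMap_branchLift]
      rfl
    · -- an edge over `(e, c)` has a branch over `(b, c)`, which abuts (properness) over `(u, σ_b c)`
      intro hw e' he'
      let b' := Hom.branchOver (ψ := θ) (⟨b, c⟩ : D.total.Branch) ⟨e', he'⟩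
      obtain ⟨w, -, hw'⟩ := hp.exists_abuts_of_branchMap_eq habuts (Hom.branchMap_branchOver _ ⟨e', he'⟩)
      exact hw w hw'
  -- hence empty
  have hempty : ¬ ((∃ u x, x ∈ SV u) ∨ (∃ e c, c ∈ SE e)) := by
    intro hne
    rcases hhit SV SE hclosed hne with ⟨w, hw⟩ | ⟨e', he'⟩
    · exact hw w rfl
    · exact he' e' rfl
  refine ⟨fun x => ?_, fun c => ?_⟩
  · by_contra h
    push Not at h
    exact hempty (Or.inl ⟨x.1, x.2, fun w hw => h w hw⟩)
  · by_contra h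
    push Not at h
    exact hempty (Or.inr ⟨c.1, c.2, fun e' he' => h e' he'⟩)

/-! ### Bijectivity of the labels -/

variable (π' : G' ⟶ K) (ℓV : ∀ w : G'.Vertex, D.FV (π'.vertexMap w))
  (ℓE : ∀ e' : G'.Edge, D.FE (π'.edgeMap e'))

/-- **The labels are bijections** (disconnected version of `labels_bijective`).  Let `π′ : 𝔾′ → 𝕂` be
proper, with labels `ℓV`, `ℓE` in fibre data `D` compatible with abutment, injective on stars with the
star count of `isExcision_of_labels`, the fibres of `π′` over every vertex `u` and edge `e` of `𝕂` being
in bijection with `F(u)`, `F(e)`; suppose that every nonempty family of components CLOSED under "the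
component under" contains a label.  Then `w ↦ (π′ w, ℓV w)` and `e′ ↦ (π′ e′, ℓE e′)` are bijective: the
labelled lift `Θ : 𝔾′ → D.total` is a graph-covering meeting every closed family, hence surjective, over
`𝕂` with the base's fibre cardinalities, hence bijective. [cite: MochizukiSemiAnbd2006, §1 p.14] -/
theorem labels_bijective_of_hits [∀ u, Finite (D.FV u)] [∀ e, Finite (D.FE e)] (hπ' : IsProper π')
    (hcompat : ∀ (b' : G'.Branch) (w : G'.Vertex) (h' : G'.abuts b' = some w),
      D.σ (π'.branchMap b') (π'.vertexMap w) (π'.abuts_branchMap b' w h')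
        (cast (congrArg D.FE (π'.edgeOf_branchMap b').symm) (ℓE (G'.edgeOf b'))) = ℓV w)
    (hinj : ∀ (w : G'.Vertex) (b'₁ b'₂ : G'.Branch), G'.abuts b'₁ = some w → G'.abuts b'₂ = some w →
      π'.branchMap b'₁ = π'.branchMap b'₂ →
      (⟨π'.edgeMap (G'.edgeOf b'₁), ℓE (G'.edgeOf b'₁)⟩ : Σ e, D.FE e) =
        ⟨π'.edgeMap (G'.edgeOf b'₂), ℓE (G'.edgeOf b'₂)⟩ → b'₁ = b'₂)
    (hcard : ∀ (w : G'.Vertex) (b : K.Branch) (hb : K.abuts b = some (π'.vertexMap w)),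
      Nat.card {c : D.FE (K.edgeOf b) // D.σ b (π'.vertexMap w) hb c = ℓV w} ≤
        Nat.card {b' : G'.Branch // G'.abuts b' = some w ∧ π'.branchMap b' = b})
    (hhit : ∀ (SV : ∀ u, Set (D.FV u)) (SE : ∀ e, Set (D.FE e)),
      (∀ (b : K.Branch) (u : K.Vertex) (hb : K.abuts b = some u) (c : D.FE (K.edgeOf b)),
        c ∈ SE (K.edgeOf b) ↔ D.σ b u hb c ∈ SV u) →
      ((∃ u x, x ∈ SV u) ∨ (∃ e c, c ∈ SE e)) →
      (∃ w, ℓV w ∈ SV (π'.vertexMap w)) ∨ (∃ e', ℓE e' ∈ SE (π'.edgeMap e')))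
    (eV : ∀ u, Nonempty (π'.VertexFiber u ≃ D.FV u))
    (eE : ∀ e, Nonempty (π'.EdgeFiber e ≃ D.FE e)) :
    Function.Bijective (fun w : G'.Vertex => (⟨π'.vertexMap w, ℓV w⟩ : Σ u, D.FV u)) ∧
      Function.Bijective (fun e' : G'.Edge => (⟨π'.edgeMap e', ℓE e'⟩ : Σ e, D.FE e)) := by
  obtain ⟨Θ, hΘ, hΘV, hΘE, hΘB⟩ := D.exists_hom_total_of_labels π' ℓV ℓE hcompat
  have hcov : IsGraphCovering Θ :=
    ⟨D.isProper_of_comp_proj_eq π' hπ' Θ hΘ,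
      D.isExcision_of_labels π' ℓV ℓE hcompat hinj hcard Θ hΘV hΘB⟩
  -- `Θ` meets every closed family, hence is surjective
  have hsurj := D.surjective_of_hits hcov fun SV SE hcl hne => by
    rcases hhit SV SE hcl hne with ⟨w, hw⟩ | ⟨e', he'⟩
    · exact Or.inl ⟨w, by rw [hΘV w]; exact hw⟩
    · exact Or.inr ⟨e', by rw [hΘE e']; exact he'⟩
  haveI : ∀ u, Finite (D.proj.VertexFiber u) := fun u => Finite.of_equiv _ (D.fibreVertexEquiv u).symm
  haveI : ∀ e, Finite (D.proj.EdgeFiber e) := fun e => Finite.of_equiv _ (D.fibreEdgeEquiv e).symm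
  haveI : ∀ u, Finite (π'.VertexFiber u) := fun u => Finite.of_equiv _ (eV u).some.symm
  haveI : ∀ e, Finite (π'.EdgeFiber e) := fun e => Finite.of_equiv _ (eE e).some.symm
  have hV : ∀ u, Nat.card (π'.VertexFiber u) = Nat.card (D.proj.VertexFiber u) := fun u =>
    (Nat.card_congr (eV u).some).trans (D.natCard_vertexFiber_proj u).symm
  have hE : ∀ e, Nat.card (π'.EdgeFiber e) = Nat.card (D.proj.EdgeFiber e) := fun e =>
    (Nat.card_congr (eE e).some).trans (D.natCard_edgeFiber_proj e).symm
  obtain ⟨hbV, hbE⟩ :=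
    Hom.bijective_of_surjective_of_natCard_fiber_eq Θ hΘ hV hE hsurj.1 hsurj.2
  have h1 : (fun w : G'.Vertex => (⟨π'.vertexMap w, ℓV w⟩ : Σ u, D.FV u)) = Θ.vertexMap :=
    funext fun w => (hΘV w).symm
  have h2 : (fun e' : G'.Edge => (⟨π'.edgeMap e', ℓE e'⟩ : Σ e, D.FE e)) = Θ.edgeMap :=
    funext fun e' => (hΘE e').symm
  rw [h1, h2]
  exact ⟨hbV, hbE⟩

end FibreData

end SemiGraph

end Literature.AnabelianGeometry.SemiGraphs
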